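import Mathlib
import HarnessLib
import Literature.MathematicalPhysics.QuantumLattice.KohnLuttinger
import Summits.HubbardSuperconductivity.HubbardSuperconductivity.Theorems.WeakCouplingBCSWcbcsKohnLuttingerB1gSublatticeDuality
import Summits.HubbardSuperconductivity.HubbardSuperconductivity.Theorems.WeakCouplingBCSKlSublatticeChannelGe

/-!
# Sublattice duality: hubbard-klscan-idea-3's items S0, S1, S2, K1, K2 HOLD («(KLSCAN)-SUBLATTICE-DUALITY-DISCHARGE» part 9,
# the bridge file; cell gate-hubbard-kl, seat p4 g20)

The reader card «sublattice-duality» (`Theorems/WeakCouplingBCSWcbcsKohnLuttingerB1gSublatticeDuality.lean`, klscan-idea-3, filed by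
p1 g23) states its items as `def … : Prop` and proves the glue.  Parts 1–8 of the discharge prove those items in the engine's
vocabulary (`klslA`, `klslTau`); this file records the two `rfl`/`cases` bridges asked for by referee ref-2
(`klslA_eq_sublatticeMap`, `klslTau_eq_tauIrrep`) and the `_holds` corollaries:

* `KlSublattice.sublatticeFormBddBelow_holds` (S0), `lindhardSublattice_holds` (S1), `fillingSublattice_holds` (S2),
  `channelInfSublatticeLe_holds` (K1), `channelInfSublatticeGe_holds` (K2);
* `KlSublattice.channelInf_sublattice_eq_holds` — the duality `channelInf ε' μ U (τχ) = channelInf ε μ U χ` on `(-4, 0)`, unconditionally;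
* `KlSublattice.dualWindowB2g_d005_d035_of_enclosures`, `KlSublattice.ratioAxisBracket_d0125_of_enclosures` — the card's dual
  `B2g` window and its `δ = 1/8` ratio-axis bracket, now conditional ONLY on the twelve enclosure hypotheses of the landed
  positive `t' = 0` window (`klb1g_window_d005_d035_const`).

Not done here: S3 `ChannelInfNNNSign` (sign of `t'`; not needed by the bracket).

Honest framing: exact identities between two free-band channel problems; the far cell `t = 0` is a relabelling of the landed
`t' = 0` theorem, physically far outside `t'/t ∈ [-0.3, 0]`; given both cells the bracket certifies only that the sign of the
`δ = 1/8` `B1g` margin changes somewhere on the hopping-ratio axis, not where or how often; nothing asserts a margin at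
`t'/t ∈ [-0.3, 0)`, the window, `K₃` or superconductivity; a Kohn–Luttinger `O(U²)` channel statement is not ODLRO.
-/

noncomputable section

set_option linter.dupNamespace false

namespace Summit.HubbardSuperconductivity.HubbardSuperconductivity.Theorems

open MeasureTheory Real Set Literature.MathematicalPhysics.QuantumLattice
open scoped ENNReal

/-! ### §17 The bridge to hubbard-klscan-idea-3's interface and the `_holds` corollaries -/

/-- **Bridge** (referee ref-2's request): the discharge engine's sublattice map IS the reader card's `sublatticeMap`. [folklore] -/
theorem klslA_eq_sublatticeMap : klslA = KlSublattice.sublatticeMap := rfl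

/-- **Bridge**: the discharge engine's twist IS the reader card's `tauIrrep`. [folklore] -/
theorem klslTau_eq_tauIrrep : klslTau = KlSublattice.tauIrrep := by
  funext χ; cases χ <;> rfl

namespace KlSublattice

/-- **S0 holds**: the `ε'` value sets are bounded below. [folklore] -/
theorem sublatticeFormBddBelow_holds : SublatticeFormBddBelow := fun _ hμ U χ => klsl_bddBelow_nnn hμ U χ

/-- **S1 holds**: `χ₀' = χ₀ ∘ A`, all `μ`, `q`. [folklore] -/
theorem lindhardSublattice_holds : LindhardSublattice := fun μ q => klsl_lindhardFunction_sublattice μ q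

/-- **S2 holds**: `n' = n`, all `μ`. [folklore] -/
theorem fillingSublattice_holds : FillingSublattice := fun μ => klsl_filling_sublattice μ

/-- **K1 holds**: `channelInf ε' μ U (τχ) ≤ channelInf ε μ U χ` on `μ ∈ (-4, 0)`. [cite: RaghuKivelsonScalapino2010, §II (13)] -/
theorem channelInfSublatticeLe_holds : ChannelInfSublatticeLe := by
  intro μ hμ U χ
  rw [← congrFun klslTau_eq_tauIrrep χ]
  exact klsl_channelInf_sublattice_le hμ U χ

/-- **K2 holds**: `min (channelInf ε μ U χ) 0 ≤ channelInf ε' μ U (τχ)` on `μ ∈ (-4, 0)`. [cite: RaghuKivelsonScalapino2010, §II (13)] -/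
theorem channelInfSublatticeGe_holds : ChannelInfSublatticeGe := by
  intro μ hμ U χ
  rw [← congrFun klslTau_eq_tauIrrep χ]
  exact klsl_channelInf_sublattice_ge hμ U χ

/-- **The sublattice duality, unconditionally**: `channelInf (squareDispersion 0 1) μ U (τχ) = channelInf (squareDispersion 1 0) μ U χ`
for `μ ∈ (-4, 0)`. [cite: RaghuKivelsonScalapino2010, §II (13)] -/
theorem channelInf_sublattice_eq_holds {μ : ℝ} (hμ : μ ∈ Set.Ioo (-4 : ℝ) 0) (U : ℝ) (χ : D4Irrep) :
    channelInf (squareDispersion 0 1) μ U (tauIrrep χ) = channelInf (squareDispersion 1 0) μ U χ :=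
  channelInf_sublattice_eq channelInfSublatticeLe_holds channelInfSublatticeGe_holds hμ U χ

/-- **The dual cell modulo ONLY the enclosures**: for the pure next-nearest-neighbour band `squareDispersion 0 1` on
`μ ∈ [-0.8925, -0.075]`, `U ∈ (0,1)`, the channel `B2g = d_{xy}` leads every other channel by `γU²`, `γ = 10371/2^20` — conditional
only on the twelve enclosure hypotheses of the landed positive `t' = 0` window (K1, K2 discharged). [cite: RaghuKivelsonScalapino2010, §II (13)] -/
theorem dualWindowB2g_d005_d035_of_enclosures
    (hU1 : klCertB1gWinU1.EnclosuresB1g) (hU2 : klCertB1gWinU2.EnclosuresB1g) (hU3 : klCertB1gWinU3.EnclosuresB1g)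
    (hV : klCertB1gWinV.EnclosuresB1g) (hW : klCertB1gWinW.EnclosuresB1g) (hX : klCertB1gWinX.EnclosuresB1g)
    (hY : klCertB1gWinY.EnclosuresB1g) (hZ : klCertB1gWinZ.EnclosuresB1g) (hA : klCertB1gWinA.EnclosuresB1g)
    (hB : klCertB1gWinB.EnclosuresB1g) (hC : klCertB1gWinC.EnclosuresB1g) (hD : klCertB1gWinD.EnclosuresB1g) :
    DualWindowB2g (10371 / 1048576) :=
  dualWindowB2g_d005_d035 channelInfSublatticeLe_holds channelInfSublatticeGe_holds hU1 hU2 hU3 hV hW hX hY hZ hA hB hC hD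

/-- **The `δ = 1/8` ratio-axis bracket modulo ONLY the enclosures** (KL-MARGIN-SCAN HQ1 (iii), second format): at hole doping
`1/8` and every `U ∈ (0,1)`, `B1g` leads by `γU²` at the `t' = 0` end and trails `B2g` by `γU²` at the `t = 0` end of the hopping-ratio
axis (K1, K2, S2 discharged; a certified bracket of a sign change, not a located or unique crossing). [cite: RaghuKivelsonScalapino2010, §II (13)] -/
theorem ratioAxisBracket_d0125_of_enclosures
    (hU1 : klCertB1gWinU1.EnclosuresB1g) (hU2 : klCertB1gWinU2.EnclosuresB1g) (hU3 : klCertB1gWinU3.EnclosuresB1g)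
    (hV : klCertB1gWinV.EnclosuresB1g) (hW : klCertB1gWinW.EnclosuresB1g) (hX : klCertB1gWinX.EnclosuresB1g)
    (hY : klCertB1gWinY.EnclosuresB1g) (hZ : klCertB1gWinZ.EnclosuresB1g) (hA : klCertB1gWinA.EnclosuresB1g)
    (hB : klCertB1gWinB.EnclosuresB1g) (hC : klCertB1gWinC.EnclosuresB1g) (hD : klCertB1gWinD.EnclosuresB1g) :
    RatioAxisBracketD0125 (10371 / 1048576) :=
  ratioAxisBracket_d0125_of_records channelInfSublatticeLe_holds channelInfSublatticeGe_holds fillingSublattice_holds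
    hU1 hU2 hU3 hV hW hX hY hZ hA hB hC hD

end KlSublattice

end Summit.HubbardSuperconductivity.HubbardSuperconductivity.Theorems

end
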